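import Summits.Parity.GeneralizedHardyLittlewood.Theorems.LeeYangFibresAbsoluteUpgradeDipDefs
import Summits.Parity.GeneralizedHardyLittlewood.Theorems.LeeYangFibresAbsoluteUpgradeAnatomyAlongAux
import Summits.Parity.GeneralizedHardyLittlewood.Theorems.LeeYangFibresModelHyperbolicityCalculus
import Summits.Parity.GeneralizedHardyLittlewood.Theorems.LeeYangFibresModelCellFactsDensityBounds
import Literature.NumberTheory.Sieve.RoughOmegaCellsAsymptotic
import Literature.NumberTheory.LFunctions.PrimesIntervalMainTerm
import HarnessLib

/-!
# Stub `stub_anatomyAlong` of line `dip-margin-rate-exchange` for crux `LeeYangFibres.AbsoluteUpgrade`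
# (stmt-Parity-14116): anatomy of rough integers along the schedule

We prove the registered stub `stub_anatomyAlong : AnatomyAlong` of the skeleton
`Cruxes/AbsoluteUpgrade/Lines/dip_margin_rate_exchange.lean`: for `N ≥ N₀` and every `1 ≤ m < U(N)`
(`U(N) = slowDegree N = max 4 ⌊√(log log N)/2⌋`), the model cell `A_m(N) = cell U N m` equals
`I_m(U) · N/log N` up to the RELATIVE error `e^{-U²}/8`.

Part 1 — **Alladi's cell asymptotics with an EXPLICIT constant** (registered helper
`anatomyAlong_explicitCellRate`).  Along the schedule both the cell index `i < U(N)` and the range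
parameter `k = U(N)` grow with `N`, so the dependence of the constant of
`#{b ≤ X : P⁻(b) ≥ Y, Ω(b) = i+1} = X I_{i+1}(u)/log X − [i = 0] Y/log Y + O_{i,k}(X/log² Y)`
(`2 ≤ Y ≤ X ≤ Y^k`) on `(i, k)` must be tracked.  The tree's
`Literature.NumberTheory.Sieve.exists_abs_cell_sub_main_le` hides it behind an existential per `(i, k)`,
but its inductive step `abs_cell_sub_main_step` carries it explicitly; re-running the induction for the
concrete densities `F_i = cellDensity i` (weights `σ_i(s) = I_{i+1}(s)/s` bounded by `B = 1` with
derivative bounded by `B' = 2`, from `I_{i+1}(s) ≤ (log s)^i/i! ≤ s`) gives the constant `A^{i+k+1}`,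
`A = 300 C₀ + 40`, `C₀` the de la Vallée Poussin constant of `|ϑ(t) − t| ≤ C₀ t/log² t`
(`exists_abs_theta_sub_self_le_div_log_sq`).

Part 2 — **the stub**.  (a) The bridge to one cell along the schedule,
`|A_m(N) log N/N − I_m(U)| ≤ 3 A^{2U} U²/log N` for `U ≥ 4`, `N ≥ 16`, `U² ≤ log N`, and the lower bound
`I_m(U) ≥ 1/(U^U)²` for `m + 1 ≤ U` (`anatomyAlong_bridge`, `anatomyAlong_densityLower_nat`, file
`LeeYangFibresAbsoluteUpgradeAnatomyAlongAux.lean`); (b) numerics: choose `M ≥ 2A + 5` and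
`N₀ = ⌈exp(exp(4(M+1)²))⌉`; for `N ≥ N₀`, `log log N ≥ 4(M+1)²`, so `U = ⌊√(log log N)/2⌋ ≥ M + 1` and
`4U² ≤ log log N`, i.e. `exp(4U²) ≤ log N`; then `24 A^{2U} U² (U^U)² ≤ A^{2U} U^{2U+5} ≤ exp(3U²)`
(as `U ≥ 2A + 5`), whence `3 A^{2U} U²/log N ≤ e^{-U²}/(8 (U^U)²) ≤ e^{-U²}/8 · I_m(U)`.

References: K. Alladi, Quart. J. Math. Oxford (2) 33 (1982) 129–148 [Alladi1982]; G. Tenenbaum,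
*Introduction to analytic and probabilistic number theory*, III.6 [Tenenbaum2015]; J. D. Lichtman,
arXiv:2109.02851, Lemma 6.1 [Lichtman2025LinearSieve] (the `O(x/log² y)` rate).
-/

noncomputable section

namespace Summit.Parity.GeneralizedHardyLittlewood.Cruxes.AbsoluteUpgrade.DipMarginRateExchange

open scoped BigOperators Chebyshev
open Literature.NumberTheory.Sieve
open Summit.Parity.GeneralizedHardyLittlewood.Cruxes.ModelHyperbolicity.WindowChainTransport
open Summit.Parity.GeneralizedHardyLittlewood.Theorems.ModelHyperbolicity.Negative (cell)
open Summit.Parity.GeneralizedHardyLittlewood.Theorems.ModelCellFacts (cellDensity_le_pow_div_factorial)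

/-! ## Explicit bounds for the densities and their weights -/

/-- `I_{j+1}(s) ≤ s` for `s ≥ 1` (`I_{j+1}(s) ≤ (log s)^j/j! ≤ e^{log s}`). -/
theorem cellDensity_le_self (j : ℕ) {s : ℝ} (hs : 1 ≤ s) : cellDensity j s ≤ s := by
  have h1 := cellDensity_le_pow_div_factorial j s hs
  have h2 := Real.pow_div_factorial_le_exp (Real.log s) (Real.log_nonneg hs) j
  rw [Real.exp_log (by linarith)] at h2
  exact h1.trans h2

/-- **Regularity of the weight `σ_j(s) = I_{j+1}(s)/s` on the window `[k−1, 2k+1]`, `k ≥ j+2`, with the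
EXPLICIT bounds `|σ_j| ≤ 1`, `|σ_j'| ≤ 2`** (continuity, derivative and continuity of the derivative are
those of `density_weight_regular`; the derivative is identified by uniqueness and bounded through
`I_{i+1}(s) ≤ s`). -/
theorem cellDensity_weight_regular (j k : ℕ) (hk : j + 2 ≤ k) :
    ∃ σ' : ℝ → ℝ,
      ContinuousOn (fun s => cellDensity j s / s) (Set.Icc ((k : ℝ) - 1) (2 * k + 1)) ∧
      (∀ s : ℝ, (k : ℝ) - 1 < s → s ≤ 2 * k + 1 →
        HasDerivAt (fun s => cellDensity j s / s) (σ' s) s) ∧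
      ContinuousOn σ' (Set.Ioc ((k : ℝ) - 1) (2 * k + 1)) ∧
      (∀ s : ℝ, (k : ℝ) - 1 ≤ s → s ≤ 2 * k + 1 → |cellDensity j s / s| ≤ 1) ∧
      (∀ s : ℝ, (k : ℝ) - 1 < s → s ≤ 2 * k + 1 → |σ' s| ≤ 2) := by
  have hF0 : ∀ s : ℝ, cellDensity 0 s = 1 := cellDensity_zero
  have hFc : ∀ i, ContinuousOn (cellDensity i) (Set.Ici 1) := fun i => (calc_continuous i).continuousOn
  have hFd : ∀ (i : ℕ) (s : ℝ), 2 < s →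
      HasDerivAt (cellDensity (i + 1)) (cellDensity i (s - 1) / (s - 1)) s :=
    fun i s hs => calc_hasDerivAt i hs
  obtain ⟨-, -, σ', -, -, hσc, hσ, hσ'c, -, -⟩ := density_weight_regular hF0 hFc hFd j k hk
  have hk2 : (2 : ℝ) ≤ k := by exact_mod_cast (le_trans (Nat.le_add_left 2 j) hk)
  refine ⟨σ', hσc, hσ, hσ'c, fun s hs _ => anatomyAlong_abs_cellDensity_div_le_one j (by linarith),
    fun s hs1 hs2 => ?_⟩
  have hs1' : (1 : ℝ) < s := by linarith
  have hs0 : (0 : ℝ) < s := by linarith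
  rcases j with _ | j
  · -- `σ_0(s) = 1/s`, `σ_0'(s) = -1/s²`
    have hd : HasDerivAt (fun s => cellDensity 0 s / s) (-(s ^ 2)⁻¹) s := by
      have hfun : (fun s => cellDensity 0 s / s) = fun s => s⁻¹ := by
        funext t; rw [cellDensity_zero, one_div]
      rw [hfun]; exact hasDerivAt_inv hs0.ne'
    rw [(hσ s hs1 hs2).unique hd, abs_neg, abs_inv, abs_of_pos (by positivity)]
    have h1 : 1 ≤ s ^ 2 := by nlinarith
    calc (s ^ 2)⁻¹ ≤ 1 := inv_le_one_of_one_le₀ h1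
      _ ≤ 2 := by norm_num
  · -- `j + 1 ≥ 1`: the window lies in `s > 2`
    have hs2' : (2 : ℝ) < s := by
      have : (3 : ℝ) ≤ k := by exact_mod_cast (le_trans (by omega) hk)
      linarith
    have hd : HasDerivAt (fun s => cellDensity (j + 1) s / s)
        ((cellDensity j (s - 1) / (s - 1) * s - cellDensity (j + 1) s * 1) / s ^ 2) s :=
      (calc_hasDerivAt j hs2').div (hasDerivAt_id' s) hs0.ne'
    rw [(hσ s hs1 hs2).unique hd]
    have h1 : |cellDensity j (s - 1) / (s - 1)| ≤ 1 := anatomyAlong_abs_cellDensity_div_le_one j (by linarith)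
    have h2 : |cellDensity (j + 1) s| ≤ s := by
      rw [abs_of_nonneg (calc_nonneg _ _)]; exact cellDensity_le_self _ hs1'.le
    rw [abs_div, abs_of_pos (by positivity : (0 : ℝ) < s ^ 2), div_le_iff₀ (by positivity), mul_one]
    calc |cellDensity j (s - 1) / (s - 1) * s - cellDensity (j + 1) s|
        ≤ |cellDensity j (s - 1) / (s - 1) * s| + |cellDensity (j + 1) s| := abs_sub _ _
      _ ≤ 1 * s + s := by
          rw [abs_mul, abs_of_pos hs0]
          exact add_le_add (mul_le_mul_of_nonneg_right h1 hs0.le) h2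
      _ ≤ 2 * s ^ 2 := by nlinarith

/-! ## Part 1: Alladi's theorem with the explicit constant `A^{i+k+1}` -/

/-- **Alladi's asymptotic for the Ω-cells of the rough integers, with a rate and an EXPLICIT constant.**
If `|ϑ(t) − t| ≤ C₀ t/log² t` for `t ≥ 2`, then with `A = 300 C₀ + 40`, for all `i, k` and all real
`2 ≤ Y ≤ X` with `log X ≤ k log Y`,
`|#{b ≤ X : P⁻(b) ≥ ⌈Y⌉, Ω(b) = i+1} − (X I_{i+1}(log X/log Y)/log X − [i = 0] Y/log Y)| ≤ A^{i+k+1} X/log² Y`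
(induction on `i`, and on `k` from the trivial range `k ≤ i + 1`, over `abs_cell_sub_main_step` with the
weight bounds `B = 1`, `B' = 2` of `cellDensity_weight_regular` and `|I_{i+1}(u)| ≤ u ≤ k + 1` in the
small-`Y` range). -/
theorem abs_cell_sub_main_le_pow {C₀ : ℝ} (hC₀ : 0 ≤ C₀)
    (hE : ∀ t : ℝ, 2 ≤ t → |θ t - t| ≤ C₀ * t / Real.log t ^ 2) :
    ∀ i k : ℕ, ∀ X Y : ℝ, 2 ≤ Y → Y ≤ X → Real.log X ≤ k * Real.log Y →
      |((((roughIcc ⌈Y⌉₊ ⌊X⌋₊).filter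
          (fun b => ArithmeticFunction.cardFactors b = i + 1)).card : ℕ) : ℝ) -
        (X * cellDensity i (Real.log X / Real.log Y) / Real.log X -
          if i = 0 then Y / Real.log Y else 0)| ≤
        (300 * C₀ + 40) ^ (i + k + 1) * X / Real.log Y ^ 2 := by
  set A : ℝ := 300 * C₀ + 40 with hA_def
  have hA40 : (40 : ℝ) ≤ A := by rw [hA_def]; linarith
  have hA1 : (1 : ℝ) ≤ A := by linarith
  have hA2 : (2 : ℝ) ≤ A := by linarith
  -- weakening of the constant
  have hweak : ∀ {c d X Y : ℝ}, 2 ≤ Y → Y ≤ X → c ≤ d →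
      c * X / Real.log Y ^ 2 ≤ d * X / Real.log Y ^ 2 := by
    intro c d X Y hY hYX hcd
    have hX0 : 0 ≤ X := by linarith
    have h0 : 0 ≤ X / Real.log Y ^ 2 := by positivity
    rw [mul_div_assoc, mul_div_assoc]
    exact mul_le_mul_of_nonneg_right hcd h0
  -- `k ≤ A^k`
  have hkA : ∀ k : ℕ, (k : ℝ) ≤ A ^ k := fun k => by
    have h1 : (k : ℝ) < 2 ^ k := by exact_mod_cast (Nat.lt_two_pow_self : k < 2 ^ k)
    exact h1.le.trans (pow_le_pow_left₀ (by norm_num) hA2 k)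
  have hFc : ∀ i, ContinuousOn (cellDensity i) (Set.Ici 1) := fun i => (calc_continuous i).continuousOn
  have hFz : ∀ (i : ℕ) (v : ℝ), v ≤ (i : ℝ) + 2 → cellDensity (i + 1) v = 0 :=
    calc_cellDensity_succ_eq_zero
  have hFrec : ∀ (i : ℕ) (v : ℝ), 2 ≤ v →
      cellDensity (i + 1) v = ∫ s in (1 : ℝ)..(v - 1), cellDensity i s / s := by
    intro i v hv
    rw [calc_cellDensity_succ, max_eq_left (by linarith)]
  intro i
  induction i with
  | zero =>
    intro k X Y hY hYX hXY
    rw [show (0 : ℕ) + 1 = 1 from rfl, card_roughIcc_filter_cardFactors_one, if_pos rfl, cellDensity_zero,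
      mul_one]
    refine (Literature.NumberTheory.LFunctions.abs_card_primes_Icc_ceil_floor_sub_le hC₀ hE hY hYX).trans
      (hweak hY hYX ?_)
    calc (20 + 12 * C₀ : ℝ) ≤ A := by rw [hA_def]; linarith
      _ = A ^ 1 := (pow_one A).symm
      _ ≤ A ^ (0 + k + 1) := pow_le_pow_right₀ hA1 (by omega)
  | succ j ih =>
    intro k
    induction k with
    | zero =>
      intro X Y hY hYX hXY
      rw [if_neg (Nat.succ_ne_zero j), sub_zero]
      refine (abs_cell_sub_main_le_of_le hFz (show 0 ≤ j + 2 by omega) hY hYX hXY).trans (hweak hY hYX ?_)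
      calc (4 : ℝ) ≤ A := by linarith
        _ = A ^ 1 := (pow_one A).symm
        _ ≤ A ^ (j + 1 + 0 + 1) := pow_le_pow_right₀ hA1 (by omega)
    | succ k ihk =>
      intro X Y hY hYX hXY
      rw [if_neg (Nat.succ_ne_zero j), sub_zero]
      by_cases hkj : k + 1 ≤ j + 2
      · refine (abs_cell_sub_main_le_of_le hFz hkj hY hYX hXY).trans (hweak hY hYX ?_)
        calc (4 : ℝ) ≤ A := by linarith
          _ = A ^ 1 := (pow_one A).symm
          _ ≤ A ^ (j + 1 + (k + 1) + 1) := pow_le_pow_right₀ hA1 (by omega)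
      push Not at hkj
      have hk : j + 2 ≤ k := by omega
      have hk2 : 2 ≤ k := by omega
      have hk2' : (2 : ℝ) ≤ k := by exact_mod_cast hk2
      -- the two induction hypotheses in the format of the step lemma
      have hPk : ∀ X Y : ℝ, 2 ≤ Y → Y ≤ X → Real.log X ≤ k * Real.log Y →
          |((((roughIcc ⌈Y⌉₊ ⌊X⌋₊).filter
              (fun b => ArithmeticFunction.cardFactors b = j + 1 + 1)).card : ℕ) : ℝ) -
            X * cellDensity (j + 1) (Real.log X / Real.log Y) / Real.log X| ≤
            A ^ (j + 1 + k + 1) * X / Real.log Y ^ 2 := by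
        intro X Y hY hYX hXY
        have h := ihk X Y hY hYX hXY
        rwa [if_neg (Nat.succ_ne_zero j), sub_zero] at h
      have hPk' := ih k
      obtain ⟨σ', hσc, hσ, hσ'c, hσb, hσ'b⟩ := cellDensity_weight_regular j k hk
      have hrec : ∀ v : ℝ, (k : ℝ) ≤ v → v ≤ k + 1 →
          ∫ s in ((k : ℝ) - 1)..(v - 1), cellDensity j s / s =
            cellDensity (j + 1) v - cellDensity (j + 1) k :=
        fun v hv _ => integral_density_div_eq_sub hFc hFrec j hk2' hv
      have hcast : ((k + 1 : ℕ) : ℝ) = (k : ℝ) + 1 := by push_cast; ring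
      rw [hcast] at hXY
      -- numerics: `P = A^{j+k+1} ≥ max(1, k)`, and the three constants are `≤ A² P`
      set P : ℝ := A ^ (j + k + 1) with hP_def
      have hP1 : 1 ≤ P := one_le_pow₀ hA1
      have hkP : (k : ℝ) ≤ P := (hkA k).trans (pow_le_pow_right₀ hA1 (by omega))
      have hP0 : 0 ≤ P := by linarith
      have e1 : A ^ (j + 1 + k + 1) = P * A := by
        rw [hP_def, show j + 1 + k + 1 = (j + k + 1) + 1 by ring, pow_succ]
      have e2 : A ^ (j + 1 + (k + 1) + 1) = P * A * A := by
        rw [hP_def, show j + 1 + (k + 1) + 1 = (j + k + 1) + 1 + 1 by ring, pow_succ, pow_succ]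
      have hPA : P * A = 300 * (P * C₀) + 40 * P := by rw [hA_def]; ring
      have hPAA : P * A * 40 ≤ P * A * A := mul_le_mul_of_nonneg_left hA40 (by positivity)
      have hkC : (k : ℝ) * C₀ ≤ P * C₀ := mul_le_mul_of_nonneg_right hkP hC₀
      have hC1 : C₀ ≤ P * C₀ := by nlinarith
      by_cases h1 : Real.log X ≤ k * Real.log Y
      · exact (hPk X Y hY hYX h1).trans (hweak hY hYX (pow_le_pow_right₀ hA1 (by omega)))
      push Not at h1
      rcases lt_or_ge Y (Real.exp 2) with h2 | h2
      · -- small `Y`: `|I_{j+2}(u)| ≤ u ≤ k + 1`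
        have hly : 0 < Real.log Y := Real.log_pos (by linarith)
        have hu1 : 1 ≤ Real.log X / Real.log Y := by
          rw [le_div_iff₀ hly, one_mul]; exact Real.log_le_log (by linarith) hYX
        have hu2 : Real.log X / Real.log Y ≤ k + 1 := by rw [div_le_iff₀ hly]; exact hXY
        have hBu : |cellDensity (j + 1) (Real.log X / Real.log Y)| ≤ k + 1 := by
          rw [abs_of_nonneg (calc_nonneg _ _)]
          exact (cellDensity_le_self _ hu1).trans hu2
        refine (abs_cell_sub_main_le_of_lt_exp_two (by positivity) hY hYX h2 hBu).trans (hweak hY hYX ?_)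
        rw [e2]
        linarith
      · refine (abs_cell_sub_main_step hk2 (by positivity) (by positivity) hC₀ zero_le_one zero_le_two hE
          hPk hPk' hσc hσ hσ'c hσb hσ'b hrec h2 hYX h1 hXY).trans (hweak hY hYX ?_)
        rw [e1, e2]
        linarith

/-- **Packaged form (registered helper `anatomyAlong_explicitCellRate`).** There is `A ≥ 2` such that for
all `i, k` and all real `2 ≤ Y ≤ X` with `log X ≤ k log Y`,
`|#{b ≤ X : P⁻(b) ≥ ⌈Y⌉, Ω(b) = i+1} − (X I_{i+1}(log X/log Y)/log X − [i = 0] Y/log Y)| ≤ A^{i+k+1} X/log² Y`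
(`abs_cell_sub_main_le_pow` with the de la Vallée Poussin constant of
`exists_abs_theta_sub_self_le_div_log_sq`).  The statement is written on one line, verbatim as registered. -/
theorem anatomyAlong_explicitCellRate : ∃ A : ℝ, 2 ≤ A ∧ ∀ i k : ℕ, ∀ X Y : ℝ, 2 ≤ Y → Y ≤ X → Real.log X ≤ k * Real.log Y → |((((roughIcc ⌈Y⌉₊ ⌊X⌋₊).filter (fun b => ArithmeticFunction.cardFactors b = i + 1)).card : ℕ) : ℝ) - (X * cellDensity i (Real.log X / Real.log Y) / Real.log X - if i = 0 then Y / Real.log Y else 0)| ≤ A ^ (i + k + 1) * X / Real.log Y ^ 2 := by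
  obtain ⟨C₀, hC₀, hE⟩ := Literature.NumberTheory.LFunctions.exists_abs_theta_sub_self_le_div_log_sq
  exact ⟨300 * C₀ + 40, by linarith, abs_cell_sub_main_le_pow hC₀ hE⟩

/-! ## Part 2: numerics and the registered stub -/

/-- **Numerics of the line**: for natural `u ≥ 4` with `u ≥ 2A + 5` (`A ≥ 2`),
`24 A^{2u} u² (u^u)² ≤ exp(3u²)` (`24u² ≤ u⁵`, `u ≤ e^u`, `A ≤ e^A`, and
`2uA + (2u+5)u ≤ 3u²`). -/
theorem anatomyAlong_numerics {A : ℝ} (hA : 2 ≤ A) {u : ℕ} (hu4 : 4 ≤ u) (huA : 2 * A + 5 ≤ u) :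
    24 * A ^ (2 * u) * (u : ℝ) ^ 2 * ((u : ℝ) ^ u) ^ 2 ≤ Real.exp (3 * (u : ℝ) ^ 2) := by
  have hu4' : (4 : ℝ) ≤ u := by exact_mod_cast hu4
  have hu0 : (0 : ℝ) ≤ u := by linarith
  have hA0 : 0 ≤ A := by linarith
  -- `24 u² ≤ u⁵`
  have h64 : (64 : ℝ) ≤ (u : ℝ) ^ 3 := by
    have h := pow_le_pow_left₀ (by norm_num : (0 : ℝ) ≤ 4) hu4' 3
    norm_num at h
    exact h
  have h24 : 24 * (u : ℝ) ^ 2 ≤ (u : ℝ) ^ 5 := by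
    have hsq : 0 ≤ (u : ℝ) ^ 2 := sq_nonneg _
    calc 24 * (u : ℝ) ^ 2 ≤ 64 * (u : ℝ) ^ 2 := by nlinarith
      _ ≤ (u : ℝ) ^ 3 * (u : ℝ) ^ 2 := mul_le_mul_of_nonneg_right h64 hsq
      _ = (u : ℝ) ^ 5 := by ring
  -- `u ≤ e^u`, `A ≤ e^A`
  have hU : (u : ℝ) ≤ Real.exp u := by linarith [Real.add_one_le_exp (u : ℝ)]
  have hAexp : A ≤ Real.exp A := by linarith [Real.add_one_le_exp A]
  have hApow : A ^ (2 * u) ≤ Real.exp A ^ (2 * u) := pow_le_pow_left₀ hA0 hAexp _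
  have hupow : (u : ℝ) ^ (2 * u + 5) ≤ Real.exp u ^ (2 * u + 5) := pow_le_pow_left₀ hu0 hU _
  have hprod : 0 ≤ A ^ (2 * u) * ((u : ℝ) ^ u) ^ 2 := by positivity
  calc 24 * A ^ (2 * u) * (u : ℝ) ^ 2 * ((u : ℝ) ^ u) ^ 2
      ≤ A ^ (2 * u) * ((u : ℝ) ^ 5 * ((u : ℝ) ^ u) ^ 2) := by
        nlinarith [mul_le_mul_of_nonneg_right h24 hprod]
    _ = A ^ (2 * u) * (u : ℝ) ^ (2 * u + 5) := by ring
    _ ≤ Real.exp A ^ (2 * u) * Real.exp u ^ (2 * u + 5) :=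
        mul_le_mul hApow hupow (by positivity) (by positivity)
    _ = Real.exp (((2 * u : ℕ) : ℝ) * A + ((2 * u + 5 : ℕ) : ℝ) * u) := by
        rw [Real.exp_add, Real.exp_nat_mul, Real.exp_nat_mul]
    _ ≤ Real.exp (3 * (u : ℝ) ^ 2) := by
        apply Real.exp_le_exp.mpr
        have h := mul_le_mul_of_nonneg_left huA hu0
        push_cast
        nlinarith [h]

/-- **Stub `stub_anatomyAlong` (registered): anatomy of rough integers ALONG THE SCHEDULE.**  For
`N ≥ N₀` and every `1 ≤ m < U(N)`, `|A_m(N) log N/N − I_m(U(N))| ≤ e^{−U(N)²}/8 · I_m(U(N))`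
(Alladi's cell asymptotics with the explicit constant, the bridge along the schedule, the lower bound
`I_m(U) ≥ 1/(U^U)²`, and `exp(4U²) ≤ log N` from `2U ≤ √(log log N)`). -/
theorem stub_anatomyAlong : AnatomyAlong := by
  unfold AnatomyAlong
  obtain ⟨A, hA2, hR⟩ := anatomyAlong_explicitCellRate
  obtain ⟨M, hM⟩ : ∃ M : ℕ, 2 * A + 5 ≤ M := exists_nat_ge (2 * A + 5)
  have hM9 : (9 : ℝ) ≤ M := by linarith
  have hM9' : 9 ≤ M := by exact_mod_cast hM9
  obtain ⟨T, hT⟩ : ∃ T : ℝ, T = 4 * ((M : ℝ) + 1) ^ 2 := ⟨_, rfl⟩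
  refine ⟨⌈Real.exp (Real.exp T)⌉₊, fun N hN m hm1 hmU => ?_⟩
  -- Step 1: the size of `N`
  have hNreal : Real.exp (Real.exp T) ≤ N := le_trans (Nat.le_ceil _) (by exact_mod_cast hN)
  have hT400 : (400 : ℝ) ≤ T := by rw [hT]; nlinarith
  have hN0 : (0 : ℝ) < N := (Real.exp_pos _).trans_le hNreal
  have hL : Real.exp T ≤ Real.log N := by
    rw [Real.le_log_iff_exp_le hN0]; exact hNreal
  have hLpos : 0 < Real.log N := (Real.exp_pos T).trans_le hL
  have hLL : T ≤ Real.log (Real.log N) := by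
    rw [Real.le_log_iff_exp_le hLpos]; exact hL
  have hll0 : 0 ≤ Real.log (Real.log N) := le_trans (by linarith) hLL
  have hN16 : 16 ≤ N := by
    have h1 : T + 1 ≤ Real.exp T := Real.add_one_le_exp T
    have h2 : Real.exp T + 1 ≤ Real.exp (Real.exp T) := Real.add_one_le_exp _
    have h3 : (16 : ℝ) ≤ N := by linarith
    exact_mod_cast h3
  -- Step 2: the schedule `U = ⌊s⌋₊`, `s = √(log log N)/2 ≥ M + 1`
  obtain ⟨s, hs⟩ : ∃ s : ℝ, s = Real.sqrt (Real.log (Real.log N)) / 2 := ⟨_, rfl⟩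
  have hUdef : slowDegree N = max 4 ⌊s⌋₊ := by rw [hs]; rfl
  have hsM : (M : ℝ) + 1 ≤ s := by
    have h1 : Real.sqrt T ≤ Real.sqrt (Real.log (Real.log N)) := Real.sqrt_le_sqrt hLL
    have h2 : Real.sqrt T = 2 * ((M : ℝ) + 1) := by
      rw [hT, show (4 : ℝ) * ((M : ℝ) + 1) ^ 2 = (2 * ((M : ℝ) + 1)) ^ 2 by ring]
      exact Real.sqrt_sq (by positivity)
    rw [hs]; linarith
  have hs0 : 0 ≤ s := le_trans (by positivity) hsM
  have hfloor : M + 1 ≤ ⌊s⌋₊ := Nat.le_floor (by exact_mod_cast hsM)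
  set U : ℕ := slowDegree N
  have hU' : U = ⌊s⌋₊ := by rw [hUdef]; exact max_eq_right (by omega)
  have hUM : M + 1 ≤ U := by rw [hU']; exact hfloor
  have hU4 : 4 ≤ U := by omega
  have hUs : (U : ℝ) ≤ s := by rw [hU']; exact Nat.floor_le hs0
  have hUA : 2 * A + 5 ≤ (U : ℝ) := by
    have h1 : (M : ℝ) + 1 ≤ U := by exact_mod_cast hUM
    linarith
  -- Step 3: `exp(4U²) ≤ log N` and `U² ≤ log N`
  have h4U : 4 * (U : ℝ) ^ 2 ≤ Real.log (Real.log N) := by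
    have hU0 : (0 : ℝ) ≤ U := Nat.cast_nonneg U
    have h1 : (2 * (U : ℝ)) ^ 2 ≤ (2 * s) ^ 2 := pow_le_pow_left₀ (by positivity) (by linarith) 2
    have h2 : (2 * s) ^ 2 = Real.log (Real.log N) := by
      rw [hs, show 2 * (Real.sqrt (Real.log (Real.log N)) / 2) = Real.sqrt (Real.log (Real.log N)) by ring,
        Real.sq_sqrt hll0]
    nlinarith
  have hexp4U : Real.exp (4 * (U : ℝ) ^ 2) ≤ Real.log N := by
    calc Real.exp (4 * (U : ℝ) ^ 2) ≤ Real.exp (Real.log (Real.log N)) := Real.exp_le_exp.mpr h4U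
      _ = Real.log N := Real.exp_log hLpos
  have hU2L : (U : ℝ) ^ 2 ≤ Real.log N := by
    have h1 : (U : ℝ) ^ 2 ≤ 4 * (U : ℝ) ^ 2 := by nlinarith [sq_nonneg (U : ℝ)]
    have h2 : 4 * (U : ℝ) ^ 2 + 1 ≤ Real.exp (4 * (U : ℝ) ^ 2) := Real.add_one_le_exp _
    linarith
  -- Step 4: bridge, lower bound, numerics
  have hbr := anatomyAlong_bridge hA2 hR hU4 hN16 hU2L hm1 hmU.le
  have hlow : 1 / ((U : ℝ) ^ U) ^ 2 ≤ cellDensity (m - 1) U :=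
    anatomyAlong_densityLower_nat (by omega : (m - 1) + 2 ≤ U)
  have hnum := anatomyAlong_numerics hA2 hU4 hUA
  have hkey : 3 * A ^ (2 * U) * (U : ℝ) ^ 2 / Real.log N ≤
      Real.exp (-((U : ℝ) ^ 2)) / 8 * (1 / ((U : ℝ) ^ U) ^ 2) := by
    have hpow0 : 0 < ((U : ℝ) ^ U) ^ 2 := by positivity
    rw [show Real.exp (-((U : ℝ) ^ 2)) / 8 * (1 / ((U : ℝ) ^ U) ^ 2) =
        Real.exp (-((U : ℝ) ^ 2)) / (8 * ((U : ℝ) ^ U) ^ 2) by field_simp,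
      div_le_div_iff₀ hLpos (by positivity)]
    have h1 : Real.exp (-((U : ℝ) ^ 2)) * Real.exp (4 * (U : ℝ) ^ 2) = Real.exp (3 * (U : ℝ) ^ 2) := by
      rw [← Real.exp_add]; ring_nf
    calc 3 * A ^ (2 * U) * (U : ℝ) ^ 2 * (8 * ((U : ℝ) ^ U) ^ 2)
        = 24 * A ^ (2 * U) * (U : ℝ) ^ 2 * ((U : ℝ) ^ U) ^ 2 := by ring
      _ ≤ Real.exp (3 * (U : ℝ) ^ 2) := hnum
      _ = Real.exp (-((U : ℝ) ^ 2)) * Real.exp (4 * (U : ℝ) ^ 2) := h1.symm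
      _ ≤ Real.exp (-((U : ℝ) ^ 2)) * Real.log N :=
          mul_le_mul_of_nonneg_left hexp4U (Real.exp_pos _).le
  calc _ ≤ 3 * A ^ (2 * U) * (U : ℝ) ^ 2 / Real.log N := hbr
    _ ≤ Real.exp (-((U : ℝ) ^ 2)) / 8 * (1 / ((U : ℝ) ^ U) ^ 2) := hkey
    _ ≤ Real.exp (-((U : ℝ) ^ 2)) / 8 * cellDensity (m - 1) U :=
        mul_le_mul_of_nonneg_left hlow (by positivity)

end Summit.Parity.GeneralizedHardyLittlewood.Cruxes.AbsoluteUpgrade.DipMarginRateExchange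

end
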